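import Literature.NumberTheory.LFunctions.NoRealZeroUpTo
import Literature.NumberTheory.LFunctions.FeketePolyaTables
import Literature.NumberTheory.LFunctions.PrimitiveQuadraticCharacterKroneckerEven
import HarnessLib

/-!
# No real zero for the real primitive characters of modulus `≤ 23`, in the kernel
# (`NoRealZeroUpTo 23`, unconditionally)

Topic `Literature/NumberTheory/LFunctions`; namespace `Literature.NumberTheory.LFunctions`
(helpers in `Literature.NumberTheory.LFunctions.SmallModuli`). THEOREMS only (no definition, no named
fact, no `sorry`): the base rows of a certified no-exceptional-zero table, proved outright.

A certified table of the no-exceptional-zero column needs a BASE below which its certificate inequality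
cannot fire (Lu–Zaman–Zhao use Platt's range; for the tiny discriminants `d = −3, −4, 5, …` the
prime-sum inequality (2.5) fails outright because `c/(r(r log q + c))` blows up as `log q → 1`). This file
supplies a kernel base, free of any named fact: **`noRealZeroUpTo_twentyThree : NoRealZeroUpTo 23`** — for
every modulus `3 ≤ q ≤ 23`, every primitive quadratic `χ` mod `q` and every `σ ∈ (0, 1)`, `L(σ, χ) ≠ 0`
(indeed `ℜL(σ, χ) > 0` for all `σ > 0`) — hence `NoExceptionalZeroUpTo 23 c` for every `c`
(`noExceptionalZeroUpTo_twentyThree`). The fifteen characters are the Kronecker symbols of the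
fundamental discriminants `−3, −4, 5, −7, ±8, −11, 12, 13, −15, 17, −19, −20, 21, −23`; the moduli
`6, 9, 10, 14, 16, 18, 22` carry no primitive quadratic character.

Method (Fekete–Pólya, MV §11.2.1 Exercise 7, engine `FeketePolyaTables.lean`): identify the values of the
ABSTRACT primitive quadratic character mod `q` with a period table (`(·/q)` for odd squarefree `q`,
`PrimitiveQuadratic.apply_natCast_eq_jacobiSym`; the tree's analysis mod `4`, `8`; CRT mod `4m`), verify the
Jacobi tables residue by residue (`norm_num`), and check by `decide` that `S_1` (odd `d ≠ −19`) or `S_2`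
(even `d`, and `d = −19` whose `S_1(3) = −1`; an odd character's `S_2` drifts upward by `S_2(q) ≥ 0` per
period — `lfunction_ne_zero_of_table_two'`) is non-negative over one period.

## References

* H. L. Montgomery, R. C. Vaughan, *Multiplicative Number Theory I*, CUP 2007, §11.2.1 Exercise 7 and
  §9.3 Theorem 9.13. [MontgomeryVaughan2007]
* J. B. Rosser, *Real roots of real Dirichlet L-series*, J. Research Nat. Bur. Standards 45 (1950)
  505–514 (the classical small-modulus verifications by partial-sum positivity). [Rosser1950RealRoots]
-/

namespace Literature.NumberTheory.LFunctions

namespace SmallModuli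

open PrimitiveQuadratic FeketePolyaTable Literature.Barriers.RiemannHypothesis
open scoped NumberTheorySymbols

/-- The table is `|l|`-periodic. [folklore] -/
private theorem tableVal_add_length (l : List ℤ) (n : ℕ) : tableVal l (n + l.length) = tableVal l n := by
  simp [tableVal]

/-- `S_1` is periodic once `S_1(|l|) = 0`. [folklore] -/
private theorem psum_add_length (l : List ℤ) (h0 : psum l l.length = 0) (N : ℕ) :
    psum l (N + l.length) = psum l N := by
  induction N with
  | zero => simpa [psum] using h0
  | succ N ih =>
    rw [show N + 1 + l.length = (N + l.length) + 1 by omega, psum, psum, ih,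
      show N + l.length + 1 = (N + 1) + l.length by omega, tableVal_add_length]

/-- `S_2` over a further period: `S_2(N + |l|) = S_2(N) + S_2(|l|)` when `S_1(|l|) = 0`. [folklore] -/
private theorem psum2_add_length (l : List ℤ) (h0 : psum l l.length = 0) (N : ℕ) :
    psum2 l (N + l.length) = psum2 l N + psum2 l l.length := by
  induction N with
  | zero => simp [psum2]
  | succ N ih =>
    rw [show N + 1 + l.length = (N + l.length) + 1 by omega, psum2, psum2, ih,
      show N + l.length + 1 = (N + 1) + l.length by omega, psum_add_length l h0]
    ring

/-- `S_2(N + k|l|) = S_2(N) + k S_2(|l|)`. [folklore] -/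
private theorem psum2_add_mul_length (l : List ℤ) (h0 : psum l l.length = 0) (k N : ℕ) :
    psum2 l (N + k * l.length) = psum2 l N + k * psum2 l l.length := by
  induction k with
  | zero => simp
  | succ k ih =>
    rw [show N + (k + 1) * l.length = (N + k * l.length) + l.length by ring, psum2_add_length l h0, ih]
    push_cast; ring

/-- **One period suffices, order two with drift**: if `S_1(|l|) = 0`, `S_2(|l|) ≥ 0` and `S_2(N) ≥ 0`
for `N ≤ |l|` (`|l| > 0`), then `S_2(N) ≥ 0` for every `N`. [cite: MontgomeryVaughan2007, §11.2.1 Exercise 7 (f)] -/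
theorem psum2_nonneg_of_check' (l : List ℤ) (hl : 0 < l.length) (h0 : psum l l.length = 0)
    (h2 : 0 ≤ psum2 l l.length) (hchk : ∀ N, N ≤ l.length → 0 ≤ psum2 l N) (N : ℕ) :
    0 ≤ psum2 l N := by
  have hN : N = N % l.length + (N / l.length) * l.length := by
    rw [mul_comm]; exact (Nat.mod_add_div N l.length).symm
  rw [hN, psum2_add_mul_length l h0]
  have := hchk _ (Nat.mod_lt N hl).le
  positivity

/-- **Order two from a table, drift allowed**: as `lfunction_ne_zero_of_table_two` with `psum2 l |l| ≥ 0`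
in place of `= 0`. [cite: MontgomeryVaughan2007, §11.2.1 Exercise 7 (f), (g)] -/
theorem lfunction_ne_zero_of_table_two' {q : ℕ} [NeZero q] (l : List ℤ) (χ : DirichletCharacter ℂ q)
    (hχ : χ ≠ 1) (hl : 0 < l.length) (hv : ∀ n : ℕ, χ (n : ZMod q) = ((tableVal l n : ℤ) : ℂ))
    (h0 : psum l l.length = 0) (h2 : 0 ≤ psum2 l l.length) (hchk : ∀ N, N ≤ l.length → 0 ≤ psum2 l N)
    {σ : ℝ} (hσ : 0 < σ) : χ.LFunction (σ : ℂ) ≠ 0 := by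
  intro h
  have hpos : 0 < (χ.LFunction (σ : ℂ)).re := by
    refine LFunction_re_pos_of_iterSummatory_two_nonneg χ hχ (fun N _ ↦ ?_) hσ
    rw [iterSummatory_two_re_eq_psum2 l χ hv]
    exact_mod_cast psum2_nonneg_of_check' l hl h0 h2 hchk N
  rw [h, Complex.zero_re] at hpos
  exact lt_irrefl _ hpos

/-- Non-units go to zero. [folklore] -/
private theorem apply_natCast_eq_zero_of_not_coprime {q : ℕ} [NeZero q] (χ : DirichletCharacter ℂ q)
    {n : ℕ} (h : ¬ n.Coprime q) : χ (n : ZMod q) = 0 :=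
  χ.map_nonunit (by rwa [ZMod.isUnit_iff_coprime])

/-- **Odd squarefree modulus**: a primitive quadratic `χ` mod `q` is `(·/q)`, so its values are those
of any table agreeing with the Jacobi symbol on the residues. [cite: MontgomeryVaughan2007, Theorem 9.13] -/
theorem apply_eq_tableVal_of_jacobi {q : ℕ} [NeZero q] (hodd : Odd q) {χ : DirichletCharacter ℂ q}
    (hprim : χ.IsPrimitive) (hquad : χ.IsQuadratic) (l : List ℤ) (hlen : l.length = q)
    (htab : ∀ k : ℕ, k < q → jacobiSym k q = tableVal l k) (n : ℕ) :
    χ (n : ZMod q) = ((tableVal l n : ℤ) : ℂ) := by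
  have hsq := squarefree_of_isPrimitive_of_isQuadratic hodd hprim hquad
  rw [apply_natCast_eq_jacobiSym hodd hsq χ hprim hquad n]
  congr 1
  rw [jacobiSym.mod_left, show ((n : ℤ) % (q : ℕ)) = ((n % q : ℕ) : ℤ) by push_cast; rfl,
    htab _ (Nat.mod_lt n (NeZero.pos q))]
  unfold tableVal
  rw [hlen, Nat.mod_mod]

/-- **Modulus `4`**: the primitive quadratic character mod `4` is `χ₋₄ = (0, 1, 0, −1)`.
[cite: MontgomeryVaughan2007, Theorem 9.13] -/
theorem apply_eq_tableVal_four {χ : DirichletCharacter ℂ 4} (hprim : χ.IsPrimitive)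
    (hquad : χ.IsQuadratic) (n : ℕ) : χ (n : ZMod 4) = ((tableVal [0, 1, 0, -1] n : ℤ) : ℂ) := by
  have h3 := apply_three_of_isPrimitive_four hprim hquad
  have htab : tableVal [0, 1, 0, -1] n = tableVal [0, 1, 0, -1] (n % 4) := by simp [tableVal]
  rw [← ZMod.natCast_mod n 4, htab]
  have hk : n % 4 < 4 := Nat.mod_lt _ (by norm_num)
  generalize n % 4 = k at hk ⊢
  interval_cases k
  · rw [apply_natCast_eq_zero_of_not_coprime χ (by decide)]; simp [tableVal]
  · simp [tableVal]
  · rw [apply_natCast_eq_zero_of_not_coprime χ (by decide)]; simp [tableVal]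
  · have : ((3 : ℕ) : ZMod 4) = 3 := rfl
    rw [this, h3]; simp [tableVal]

/-- **Modulus `8`**: a primitive quadratic character mod `8` is `χ₋₈ = (0,1,0,1,0,−1,0,−1)` if
`χ(3) = 1` and `χ₈ = (0,1,0,−1,0,−1,0,1)` if `χ(3) = −1` (and `χ(3) = ±1`).
[cite: MontgomeryVaughan2007, Theorem 9.13] -/
theorem apply_eq_tableVal_eight {χ : DirichletCharacter ℂ 8} (hprim : χ.IsPrimitive)
    (hquad : χ.IsQuadratic) :
    (χ (3 : ZMod 8) = 1 ∧ ∀ n : ℕ, χ (n : ZMod 8) = ((tableVal [0, 1, 0, 1, 0, -1, 0, -1] n : ℤ) : ℂ)) ∨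
    (χ (3 : ZMod 8) = -1 ∧ ∀ n : ℕ, χ (n : ZMod 8) = ((tableVal [0, 1, 0, -1, 0, -1, 0, 1] n : ℤ) : ℂ)) := by
  have h5 := apply_five_of_isPrimitive_eight hprim hquad
  have h7 : χ (7 : ZMod 8) = -χ (3 : ZMod 8) := by
    rw [show (7 : ZMod 8) = 3 * 5 by decide, map_mul, h5, mul_neg_one]
  have hvals : ∀ n : ℕ, χ (n : ZMod 8) =
      if n % 8 = 1 then 1 else if n % 8 = 3 then χ (3 : ZMod 8) else if n % 8 = 5 then -1
        else if n % 8 = 7 then -χ (3 : ZMod 8) else 0 := by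
    intro n
    rw [← ZMod.natCast_mod n 8]
    have hk : n % 8 < 8 := Nat.mod_lt _ (by norm_num)
    generalize n % 8 = k at hk ⊢
    interval_cases k
    · rw [apply_natCast_eq_zero_of_not_coprime χ (by decide)]; simp
    · simp
    · rw [apply_natCast_eq_zero_of_not_coprime χ (by decide)]; simp
    · simp
    · rw [apply_natCast_eq_zero_of_not_coprime χ (by decide)]; simp
    · simpa using h5
    · rw [apply_natCast_eq_zero_of_not_coprime χ (by decide)]; simp
    · simpa using h7
  rcases apply_eq_one_or_neg_one_of_isUnit hquad (by decide : IsUnit (3 : ZMod 8)) with h3 | h3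
  · left
    refine ⟨h3, fun n ↦ ?_⟩
    rw [hvals n, h3]
    have htab : tableVal [0, 1, 0, 1, 0, -1, 0, -1] n = tableVal [0, 1, 0, 1, 0, -1, 0, -1] (n % 8) := by
      simp [tableVal]
    rw [htab]
    have hk : n % 8 < 8 := Nat.mod_lt _ (by norm_num)
    generalize n % 8 = k at hk ⊢
    interval_cases k <;> simp [tableVal]
  · right
    refine ⟨h3, fun n ↦ ?_⟩
    rw [hvals n, h3]
    have htab : tableVal [0, 1, 0, -1, 0, -1, 0, 1] n = tableVal [0, 1, 0, -1, 0, -1, 0, 1] (n % 8) := by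
      simp [tableVal]
    rw [htab]
    have hk : n % 8 < 8 := Nat.mod_lt _ (by norm_num)
    generalize n % 8 = k at hk ⊢
    interval_cases k <;> simp [tableVal]

/-- **Modulus `4m`, `m` odd** (CRT): the values are `χ₋₄(n) · (n/m)`, so those of any `4m`-periodic
table agreeing with that product on the residues. [cite: MontgomeryVaughan2007, Lemma 9.3 and Theorem 9.13] -/
theorem apply_eq_tableVal_four_mul {m : ℕ} [NeZero m] (hm : Odd m)
    {χ : DirichletCharacter ℂ (2 ^ 2 * m)} (hprim : χ.IsPrimitive) (hquad : χ.IsQuadratic)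
    (l : List ℤ) (hlen : l.length = 2 ^ 2 * m)
    (htab : ∀ k : ℕ, k < 2 ^ 2 * m → tableVal [0, 1, 0, -1] k * jacobiSym k m = tableVal l k) (n : ℕ) :
    χ (n : ZMod (2 ^ 2 * m)) = ((tableVal l n : ℤ) : ℂ) := by
  have hcop := coprime_two_pow_of_odd 2 hm
  rw [apply_natCast_eq_crtFst_mul_jacobiSym hm hprim hquad n,
    apply_eq_tableVal_four (isPrimitive_crtFst hcop hprim) (IsQuadratic.crtFst hcop hquad) n]
  rw [← Int.cast_mul]
  congr 1
  have hq0 : 0 < 2 ^ 2 * m := NeZero.pos _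
  -- reduce to the residue `n % (4m)`
  have h1 : tableVal [0, 1, 0, -1] n = tableVal [0, 1, 0, -1] (n % (2 ^ 2 * m)) := by
    unfold tableVal
    simp only [List.length_cons, List.length_nil]
    rw [Nat.mod_mod_of_dvd n (by norm_num : (0 + 1 + 1 + 1 + 1) ∣ 2 ^ 2 * m)]
  have h2 : jacobiSym (n : ℤ) m = jacobiSym ((n % (2 ^ 2 * m) : ℕ) : ℤ) m := by
    rw [jacobiSym.mod_left (n : ℤ) m, jacobiSym.mod_left ((n % (2 ^ 2 * m) : ℕ) : ℤ) m]
    congr 1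
    push_cast
    exact (Int.emod_emod_of_dvd _ (Dvd.intro_left _ rfl : (m : ℤ) ∣ 4 * m)).symm
  have h3 : tableVal l n = tableVal l (n % (2 ^ 2 * m)) := by
    unfold tableVal; rw [hlen, Nat.mod_mod]
  rw [h1, h2, h3]
  exact htab _ (Nat.mod_lt n hq0)

/-- Primitive characters of modulus `≥ 2` are non-trivial. [folklore] -/
private theorem ne_one {q : ℕ} [NeZero q] {χ : DirichletCharacter ℂ q} (hprim : χ.IsPrimitive)
    (hq : 2 ≤ q) : χ ≠ 1 :=
  SiegelZeroQuality.ne_one_of_isPrimitive hprim hq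

/-- Odd squarefree modulus, order one. [folklore] -/
private theorem good_of_jacobi_one {q : ℕ} [NeZero q] (hodd : Odd q) (hq : 2 ≤ q) (l : List ℤ)
    (hlen : l.length = q) (htab : ∀ k : ℕ, k < q → jacobiSym k q = tableVal l k)
    (h0 : psum l l.length = 0) (hchk : ∀ N, N ≤ l.length → 0 ≤ psum l N) :
    ∀ χ : DirichletCharacter ℂ q, χ.IsQuadratic → χ.IsPrimitive →
      ∀ σ : ℝ, 0 < σ → σ < 1 → χ.LFunction σ ≠ 0 := by
  intro χ hquad hprim σ hσ _
  exact lfunction_ne_zero_of_table_one l χ (ne_one hprim hq) (by rw [hlen]; omega)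
    (apply_eq_tableVal_of_jacobi hodd hprim hquad l hlen htab) h0 hchk hσ

/-- Odd squarefree modulus, order two (drift allowed). [folklore] -/
private theorem good_of_jacobi_two {q : ℕ} [NeZero q] (hodd : Odd q) (hq : 2 ≤ q) (l : List ℤ)
    (hlen : l.length = q) (htab : ∀ k : ℕ, k < q → jacobiSym k q = tableVal l k)
    (h0 : psum l l.length = 0) (h2 : 0 ≤ psum2 l l.length)
    (hchk : ∀ N, N ≤ l.length → 0 ≤ psum2 l N) :
    ∀ χ : DirichletCharacter ℂ q, χ.IsQuadratic → χ.IsPrimitive →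
      ∀ σ : ℝ, 0 < σ → σ < 1 → χ.LFunction σ ≠ 0 := by
  intro χ hquad hprim σ hσ _
  exact lfunction_ne_zero_of_table_two' l χ (ne_one hprim hq) (by rw [hlen]; omega)
    (apply_eq_tableVal_of_jacobi hodd hprim hquad l hlen htab) h0 h2 hchk hσ

/-- `d = −4` (order one). [folklore] -/
private theorem good4 :
    ∀ χ : DirichletCharacter ℂ 4, χ.IsQuadratic → χ.IsPrimitive →
      ∀ σ : ℝ, 0 < σ → σ < 1 → χ.LFunction σ ≠ 0 := by
  intro χ hquad hprim σ hσ _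
  exact lfunction_ne_zero_of_table_one [0, 1, 0, -1] χ (ne_one hprim (by norm_num)) (by decide)
    (apply_eq_tableVal_four hprim hquad) (by decide) (by decide) hσ

/-- `d = −8` (order one) and `d = 8` (order two). [folklore] -/
private theorem good8 :
    ∀ χ : DirichletCharacter ℂ 8, χ.IsQuadratic → χ.IsPrimitive →
      ∀ σ : ℝ, 0 < σ → σ < 1 → χ.LFunction σ ≠ 0 := by
  intro χ hquad hprim σ hσ _
  rcases apply_eq_tableVal_eight hprim hquad with ⟨-, hv⟩ | ⟨-, hv⟩
  · exact lfunction_ne_zero_of_table_one _ χ (ne_one hprim (by norm_num)) (by decide) hv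
      (by decide) (by decide) hσ
  · exact lfunction_ne_zero_of_table_two _ χ (ne_one hprim (by norm_num)) (by decide) hv
      (by decide) (by decide) (by decide) hσ

/-- `d = 12`, modulus `4·3` (order two). [folklore] -/
private theorem good12 :
    ∀ χ : DirichletCharacter ℂ (2 ^ 2 * 3), χ.IsQuadratic → χ.IsPrimitive →
      ∀ σ : ℝ, 0 < σ → σ < 1 → χ.LFunction σ ≠ 0 := by
  intro χ hquad hprim σ hσ _
  exact lfunction_ne_zero_of_table_two [0, 1, 0, 0, 0, -1, 0, -1, 0, 0, 0, 1] χ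
    (ne_one hprim (by norm_num)) (by decide)
    (apply_eq_tableVal_four_mul (by decide) hprim hquad _ rfl
      (by intro k hk; interval_cases k <;> norm_num <;> decide))
    (by decide) (by decide) (by decide) hσ

/-- `d = −20`, modulus `4·5` (order one). [folklore] -/
private theorem good20 :
    ∀ χ : DirichletCharacter ℂ (2 ^ 2 * 5), χ.IsQuadratic → χ.IsPrimitive →
      ∀ σ : ℝ, 0 < σ → σ < 1 → χ.LFunction σ ≠ 0 := by
  intro χ hquad hprim σ hσ _
  exact lfunction_ne_zero_of_table_one
    [0, 1, 0, 1, 0, 0, 0, 1, 0, 1, 0, -1, 0, -1, 0, 0, 0, -1, 0, -1] χ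
    (ne_one hprim (by norm_num)) (by decide)
    (apply_eq_tableVal_four_mul (by decide) hprim hquad _ rfl
      (by intro k hk; interval_cases k <;> norm_num <;> decide))
    (by decide) (by decide) hσ

/-- Moduli `2m`, `m` odd: no primitive character at all. [folklore] -/
private theorem good_two_mul {m : ℕ} [NeZero m] (hm : Odd m) :
    ∀ χ : DirichletCharacter ℂ (2 ^ 1 * m), χ.IsQuadratic → χ.IsPrimitive →
      ∀ σ : ℝ, 0 < σ → σ < 1 → χ.LFunction σ ≠ 0 :=
  fun _ _ hprim ↦ (not_isPrimitive_two_mul hm hprim).elim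

/-- Modulus `9` is not squarefree: no primitive quadratic character. [folklore] -/
private theorem good9 :
    ∀ χ : DirichletCharacter ℂ 9, χ.IsQuadratic → χ.IsPrimitive →
      ∀ σ : ℝ, 0 < σ → σ < 1 → χ.LFunction σ ≠ 0 := by
  intro χ hquad hprim
  have h := squarefree_of_isPrimitive_of_isQuadratic (by decide : Odd 9) hprim hquad
  have h3 := Nat.isUnit_iff.mp (h 3 (by norm_num))
  omega

/-- Modulus `16 = 2⁴`: no primitive quadratic character. [folklore] -/
private theorem good16 :
    ∀ χ : DirichletCharacter ℂ (2 ^ 4), χ.IsQuadratic → χ.IsPrimitive →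
      ∀ σ : ℝ, 0 < σ → σ < 1 → χ.LFunction σ ≠ 0 := by
  intro χ hquad hprim
  have := level_two_pow_le_three hprim hquad
  omega

end SmallModuli

open SmallModuli in
/-- **`NoRealZeroUpTo 23`, unconditionally**: for every modulus `3 ≤ q ≤ 23`, every primitive quadratic
Dirichlet character `χ` mod `q` and every real `σ ∈ (0, 1)`, `L(σ, χ) ≠ 0`. (Fekete–Pólya partial-sum
positivity of order one — `d = −3, −4, −7, −8, −11, −15, −20, −23` — or two — `d = 5, 8, 12, 13, 17, −19, 21` —
checked by `decide` over one period; the remaining moduli carry no primitive quadratic character.)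
[cite: MontgomeryVaughan2007, §11.2.1 Exercise 7] -/
theorem noRealZeroUpTo_twentyThree : NoRealZeroUpTo 23 := by
  intro q _ hq3 hq23 χ hquad hprim σ hσ0 hσ1
  interval_cases q
  · exact good_of_jacobi_one (q := 3) (by decide) (by norm_num)
      [0, 1, -1] rfl
      (by intro k hk; interval_cases k <;> norm_num <;> decide) (by decide) (by decide)
      χ hquad hprim σ hσ0 hσ1
  · exact good4 χ hquad hprim σ hσ0 hσ1
  · exact good_of_jacobi_two (q := 5) (by decide) (by norm_num)
      [0, 1, -1, -1, 1] rfl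
      (by intro k hk; interval_cases k <;> norm_num <;> decide) (by decide) (by decide) (by decide)
      χ hquad hprim σ hσ0 hσ1
  · exact good_two_mul (m := 3) (by decide) χ hquad hprim σ hσ0 hσ1
  · exact good_of_jacobi_one (q := 7) (by decide) (by norm_num)
      [0, 1, 1, -1, 1, -1, -1] rfl
      (by intro k hk; interval_cases k <;> norm_num <;> decide) (by decide) (by decide)
      χ hquad hprim σ hσ0 hσ1
  · exact good8 χ hquad hprim σ hσ0 hσ1
  · exact good9 χ hquad hprim σ hσ0 hσ1
  · exact good_two_mul (m := 5) (by decide) χ hquad hprim σ hσ0 hσ1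
  · exact good_of_jacobi_one (q := 11) (by decide) (by norm_num)
      [0, 1, -1, 1, 1, 1, -1, -1, -1, 1, -1] rfl
      (by intro k hk; interval_cases k <;> norm_num <;> decide) (by decide) (by decide)
      χ hquad hprim σ hσ0 hσ1
  · exact good12 χ hquad hprim σ hσ0 hσ1
  · exact good_of_jacobi_two (q := 13) (by decide) (by norm_num)
      [0, 1, -1, 1, 1, -1, -1, -1, -1, 1, 1, -1, 1] rfl
      (by intro k hk; interval_cases k <;> norm_num <;> decide) (by decide) (by decide) (by decide)
      χ hquad hprim σ hσ0 hσ1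
  · exact good_two_mul (m := 7) (by decide) χ hquad hprim σ hσ0 hσ1
  · exact good_of_jacobi_one (q := 15) (by decide) (by norm_num)
      [0, 1, 1, 0, 1, 0, 0, -1, 1, 0, 0, -1, 0, -1, -1] rfl
      (by intro k hk; interval_cases k <;> norm_num <;> decide) (by decide) (by decide)
      χ hquad hprim σ hσ0 hσ1
  · exact good16 χ hquad hprim σ hσ0 hσ1
  · exact good_of_jacobi_two (q := 17) (by decide) (by norm_num)
      [0, 1, 1, -1, 1, -1, -1, -1, 1, 1, -1, -1, -1, 1, -1, 1, 1] rfl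
      (by intro k hk; interval_cases k <;> norm_num <;> decide) (by decide) (by decide) (by decide)
      χ hquad hprim σ hσ0 hσ1
  · exact good_two_mul (m := 9) (by decide) χ hquad hprim σ hσ0 hσ1
  · exact good_of_jacobi_two (q := 19) (by decide) (by norm_num)
      [0, 1, -1, -1, 1, 1, 1, 1, -1, 1, -1, 1, -1, -1, -1, -1, 1, 1, -1] rfl
      (by intro k hk; interval_cases k <;> norm_num <;> decide) (by decide) (by decide) (by decide)
      χ hquad hprim σ hσ0 hσ1
  · exact good20 χ hquad hprim σ hσ0 hσ1
  · exact good_of_jacobi_two (q := 21) (by decide) (by norm_num)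
      [0, 1, -1, 0, 1, 1, 0, 0, -1, 0, -1, -1, 0, -1, 0, 0, 1, 1, 0, -1, 1] rfl
      (by intro k hk; interval_cases k <;> norm_num <;> decide) (by decide) (by decide) (by decide)
      χ hquad hprim σ hσ0 hσ1
  · exact good_two_mul (m := 11) (by decide) χ hquad hprim σ hσ0 hσ1
  · exact good_of_jacobi_one (q := 23) (by decide) (by norm_num)
      [0, 1, 1, 1, 1, -1, 1, -1, 1, 1, -1, -1, 1, 1, -1, -1, 1, -1, 1, -1, -1, -1, -1] rfl
      (by intro k hk; interval_cases k <;> norm_num <;> decide) (by decide) (by decide)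
      χ hquad hprim σ hσ0 hσ1

/-- **`NoExceptionalZeroUpTo 23 c` for every `c`, unconditionally** — a named-fact-free base table for
certificates indexed by larger discriminants. [cite: MontgomeryVaughan2007, §11.2.1 Exercise 7] -/
theorem noExceptionalZeroUpTo_twentyThree (c : ℝ) : NoExceptionalZeroUpTo 23 c :=
  noRealZeroUpTo_twentyThree.noExceptionalZeroUpTo c

end Literature.NumberTheory.LFunctions
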